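import Summits.AtomisticToContinuum.Crystallization.Theorems.ContactSaturationLadderChunkProfile
import HarnessLib

/-!
# ContactSaturationLadderChunkNear — the ORDER STRUCTURE of the residual pair of crux `LooseTextureRung`, part 3 of 3:
the NEAR side modulo the window ceiling — one-rung kernel, merger, exact cut, quantisation (helper, supports item 30303)

Helper for route `ContactSaturationLadder` (sub-problem `Crystallization`), crux `LooseTextureRung`
(stmt-AtomisticToContinuum-30303, DECLARED RESIDUAL-CORE), registered line «DialFreeSieveV6» v6.3 (lens-1 lineage `decomp-a2c-lens-1`,
cell `decomp-a2c`; the registered skeleton and its stubs are UNTOUCHED — nothing here is a registered item).  LANDING PICKED by the cell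
critic (`decomp-a2c-crit-1`, CRITIC-LEDGER row 283 (ε), bus STATUS l.1402): «Theorems landing of the GS-free, route-independent §30/§31
order lemmas (recentring kernel, door ⟹ rung, NLC ⟺ ∃ r NoLooseChunkAt r, NLC ⟺ NEAR(φ) ∧ Φ_∞ < φ, DIP ⟸ FCE) as a helper».  Source: the
lineage node g23 (`LooseTextureRung_node_g23.lean`, sha256 d04ae943…, §24–§31, kernel-checked there against the tree item).  Every statement
below is PROVED (0 sorry, standard axioms).
PART 3 (this file) continues PART 1 `ContactSaturationLadderChunkDoor` and PART 2 `ContactSaturationLadderChunkProfile` (same namespace;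
marker-generic, Theses-free — see PART 1's header).  The one energy input of the NEAR side, the ground-state WINDOW CEILING, is a TREE
theorem (`ContactSaturationLadderWindowCeiling.gsWindowCeiling`, p797612) whose module lies in the import cone of the route's Theses file, so it
enters here as the HYPOTHESIS `(hC : GSWindowCeiling)`, discharged by that theorem at the point of use (`gsWindowCeiling_of_inf`: the literal
tree statement IS `GSWindowCeiling`, `eStar` unfolding by `rfl`).

## Contents

§6 `MarkedNearCertAt F ρ₁ φ κ` / NEAR(φ) `MarkedNearGapAt F φ` (admissible windows with marked fraction `≤ φ` pay `κ > 0` per particle above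
   `e⋆`, eventually in the radius); CEIL `GSWindowCeiling`; NLC ⟹ NEAR (vacuous); THE ONE-RUNG KERNEL (NEAR(φ_N) ∧ one rung
   `NoMarkedChunkAt F ρ φ`, `ρ ≥ 1`, `φ < φ_N` ⟹ NLC); THE MERGER NLC ⟺ NEAR ∧ exclusion for EVERY marker (so the marker is immaterial);
   THE EXACT CUT NLC ⟺ NEAR(φ) ∧ `Φ_∞(F) < φ` (every `φ > 0`), at one radius / one door; THE QUANTISATION `Φ_∞ = 0 ∨ φ_N ≤ Φ_∞`;
   «`Φ_∞ < φ`» ⟺ exclusion modulo NEAR(φ); THE DOOR LADDER at one radius (CEIL-free order).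
§7 PRICING (marker-generic port of the node's §32): PAY(κ₀) `MarkedPay F κ₀` (unmarked particles pay `κ₀` each — fraction-free), SLACK(σ)
   `MarkedSlack F σ` (marked particles at most `σ` below `e⋆`), the pricing kernel PAY ∧ SLACK ⟹ NEAR(φ) for `φ·(κ₀+σ) < κ₀`, the THRESHOLD-FREE
   CUT NLC ⟸ PAY(κ₀) ∧ SLACK(σ) ∧ `Φ_∞(F) < κ₀/(κ₀+σ)`; the GS-free, `N`-free POINTWISE FLOOR `SiteFloor d m` (every particle of an injective
   `d`-separated configuration has site energy `≥ m`; a certified-computation target) with SLACK ⟸ floor at a proved separation (`gsMinDist`, `7/10`)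
   and the priced cut from a certified floor.
-/

noncomputable section

open scoped BigOperators Topology Classical
open Filter Metric
open Literature.MathematicalPhysics.StatisticalMechanics (lennardJones IsGroundState siteEnergy PeriodicConfiguration)
open Summit.AtomisticToContinuum.Crystallization.Theorems.ChargedEnergyGapNegative (eStar)
open Summit.AtomisticToContinuum.Crystallization.Theorems
open Summit.AtomisticToContinuum.Crystallization.Theorems.ContactSaturationLadderHaloCount (looseSet voidAdjSet)

namespace Summit.AtomisticToContinuum.Crystallization.Theorems.ContactSaturationLadderChunkDoor

/-! ## §6 The NEAR side modulo the window ceiling: the one-rung kernel, the merger, the quantisation -/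

/-- **`MarkedNearCertAt F ρ₁ φ κ`** — NEAR at one radius: every all-`(3/50)`-loose, 2-void-free doubled ground-state window `B(c,2ρ₁)` whose
inner window has marked fraction `≤ φ` PAYS `κ` per particle above `e⋆`: `κ·#B(c,ρ₁) ≤ Σ_{B(c,ρ₁)} (𝓔ⁱ/2 − e⋆)`. -/
def MarkedNearCertAt (F : SiteMarker) (ρ₁ φ κ : ℝ) : Prop :=
  ∀ (N : ℕ) (y : Fin N → EuclideanSpace ℝ (Fin 3)), IsGroundState lennardJones y →
    ∀ c : EuclideanSpace ℝ (Fin 3),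
      (∀ i : Fin N, dist (y i) c ≤ 2 * ρ₁ → i ∈ looseSet (3 / 50) y) →
        (∀ i : Fin N, dist (y i) c ≤ 2 * ρ₁ → i ∉ voidAdjSet 2 y) →
          ((Finset.univ.filter fun i : Fin N => dist (y i) c ≤ ρ₁ ∧ i ∈ F N y).card : ℝ)
              ≤ φ * ((Finset.univ.filter fun i : Fin N => dist (y i) c ≤ ρ₁).card : ℝ) →
            κ * ((Finset.univ.filter fun i : Fin N => dist (y i) c ≤ ρ₁).card : ℝ)
              ≤ ∑ i ∈ Finset.univ.filter (fun i : Fin N => dist (y i) c ≤ ρ₁), (siteEnergy lennardJones y i / 2 - eStar)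

/-- **NEAR(φ) · `MarkedNearGapAt F φ`**: some price `κ > 0`, eventually in the radius, `MarkedNearCertAt F ρ₁ φ κ`. -/
def MarkedNearGapAt (F : SiteMarker) (φ : ℝ) : Prop :=
  ∃ κ : ℝ, 0 < κ ∧ ∃ ρe : ℝ, ∀ ρ₁ : ℝ, ρe ≤ ρ₁ → MarkedNearCertAt F ρ₁ φ κ

/-- **CEIL · `GSWindowCeiling`** — the ground-state WINDOW CEILING, taken as a HYPOTHESIS in this file: for every `ε > 0`, at all large radii,
every window of a Lennard-Jones ground state has `Σ_{B(p,ρ)} (𝓔ⁱ/2 − e⋆) ≤ ε·#B(p,ρ) + ε·ρ³`.  PROVED in the tree as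
`ContactSaturationLadderWindowCeiling.gsWindowCeiling` (p797612; `eStar` unfolds to its inlined infimum by `rfl`) — that module lies in the
import cone of the route's Theses file, so the theorem is supplied by the consumer, not imported here. -/
def GSWindowCeiling : Prop :=
  ∀ ε : ℝ, 0 < ε → ∃ ρc : ℝ, ∀ ρ : ℝ, ρc ≤ ρ →
    ∀ (N : ℕ) (y : Fin N → EuclideanSpace ℝ (Fin 3)), IsGroundState lennardJones y → ∀ p : EuclideanSpace ℝ (Fin 3),
      ∑ i ∈ Finset.univ.filter (fun i : Fin N => dist (y i) p ≤ ρ), (siteEnergy lennardJones y i / 2 - eStar)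
        ≤ ε * ((Finset.univ.filter fun i : Fin N => dist (y i) p ≤ ρ).card : ℝ) + ε * ρ ^ 3

/-- The ceiling in the LITERAL form of the TREE theorem `ContactSaturationLadderWindowCeiling.gsWindowCeiling` (`e⋆` spelled as the infimum over
periodic configurations) IS `GSWindowCeiling` (`eStar` unfolds by `rfl`): consumers write `gsWindowCeiling_of_inf gsWindowCeiling`. -/
theorem gsWindowCeiling_of_inf
    (h : ∀ ε : ℝ, 0 < ε → ∃ ρc : ℝ, ∀ ρ : ℝ, ρc ≤ ρ →
      ∀ (N : ℕ) (y : Fin N → EuclideanSpace ℝ (Fin 3)), IsGroundState lennardJones y → ∀ p : EuclideanSpace ℝ (Fin 3),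
        ∑ i ∈ Finset.univ.filter (fun i : Fin N => dist (y i) p ≤ ρ),
            (siteEnergy lennardJones y i / 2 - ⨅ Q : PeriodicConfiguration 3, Q.energyPerParticle lennardJones)
          ≤ ε * ((Finset.univ.filter fun i : Fin N => dist (y i) p ≤ ρ).card : ℝ) + ε * ρ ^ 3) :
    GSWindowCeiling := h

/-- NEAR at a larger fraction is stronger. -/
theorem markedNearGapAt_mono_phi {F : SiteMarker} {φ φ' : ℝ} (hφ : φ ≤ φ') (h : MarkedNearGapAt F φ') : MarkedNearGapAt F φ := by
  obtain ⟨κ, hκ, ρe, h⟩ := h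
  refine ⟨κ, hκ, ρe, fun ρ₁ hρ₁ N y hy c hl hv hfrac => h ρ₁ hρ₁ N y hy c hl hv ?_⟩
  have hB : (0 : ℝ) ≤ ((Finset.univ.filter fun i : Fin N => dist (y i) c ≤ ρ₁).card : ℝ) := by positivity
  exact hfrac.trans (mul_le_mul_of_nonneg_right hφ hB)

/-- **NLC ⟹ NEAR at EVERY marker, fraction and price** (vacuously: an empty inner window pays `κ·0`). -/
theorem markedNearGapAt_of_noLooseChunks (h : NoLooseChunks) (F : SiteMarker) (φ : ℝ) : MarkedNearGapAt F φ := by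
  obtain ⟨ρ₀, h⟩ := h
  refine ⟨1, one_pos, ρ₀, fun ρ₁ hρ₁ N y hy c hl hv _ => ?_⟩
  have hempty : (Finset.univ.filter fun i : Fin N => dist (y i) c ≤ ρ₁) = ∅ :=
    Finset.filter_eq_empty_iff.mpr fun i _ hi => absurd hi (not_le.mpr (h ρ₁ hρ₁ N y hy c hl hv i))
  rw [hempty, Finset.card_empty, Nat.cast_zero, mul_zero, Finset.sum_empty]

/-- **THE ONE-RUNG KERNEL** (modulo CEIL): NEAR at fraction `φ_N` and ONE rung `NoMarkedChunkAt F ρ φ` at ONE radius `ρ ≥ 1` with `0 ≤ φ < φ_N`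
give NLC — via K5♯ the rung reaches every large radius with fraction `< φ_N`, then NEAR makes the window PAY `κ·#B`, CEIL caps the payment by
`ε·(#B + ρ³)`, filling turns `ρ³` into `8·#B`: at `ε = κ/18` the inner window is EMPTY. -/
theorem noLooseChunks_of_nearAt_rung (hC : GSWindowCeiling) {F : SiteMarker} {φN ρ φ : ℝ} (hN : MarkedNearGapAt F φN)
    (hρ : 1 ≤ ρ) (hφ0 : 0 ≤ φ) (hφ : φ < φN) (hR : NoMarkedChunkAt F ρ φ) : NoLooseChunks := by
  obtain ⟨κ, hκ, ρe, hN⟩ := hN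
  obtain ⟨C, hC0, htr⟩ := noMarkedChunkAt_transfer
  obtain ⟨ρc, hceil⟩ := hC (κ / 18) (by positivity)
  -- radius beyond which the transferred fraction φ(1 + Cρ/ρ₁) is ≤ φN
  have hgap : 0 < φN - φ := by linarith
  refine ⟨max (max (3 * ρ) 18) (max (max ρe ρc) (C * ρ * φ / (φN - φ) + 1)), fun ρ₁ hρ₁ N y hy c hl hv i => ?_⟩
  have h3 : 3 * ρ ≤ ρ₁ := le_trans (le_trans (le_max_left _ _) (le_max_left _ _)) hρ₁
  have h18 : 18 ≤ ρ₁ := le_trans (le_trans (le_max_right _ _) (le_max_left _ _)) hρ₁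
  have hρe : ρe ≤ ρ₁ := le_trans (le_trans (le_trans (le_max_left _ _) (le_max_left _ _)) (le_max_right _ _)) hρ₁
  have hρc : ρc ≤ ρ₁ := le_trans (le_trans (le_trans (le_max_right _ _) (le_max_left _ _)) (le_max_right _ _)) hρ₁
  have hT : C * ρ * φ / (φN - φ) < ρ₁ := lt_of_lt_of_le (by linarith) (le_trans (le_trans (le_max_right _ _) (le_max_right _ _)) hρ₁)
  have hρ₁0 : 0 < ρ₁ := by linarith
  by_contra hin
  rw [not_lt] at hin
  set B := Finset.univ.filter (fun j : Fin N => dist (y j) c ≤ ρ₁) with hB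
  -- the transferred rung at ρ₁ has fraction ≤ φN
  have hfrac : φ * (1 + C * (ρ / ρ₁)) ≤ φN := by
    have h1 : C * ρ * φ < ρ₁ * (φN - φ) := by rwa [div_lt_iff₀ hgap] at hT
    have e : φ * (1 + C * (ρ / ρ₁)) = φ + C * ρ * φ / ρ₁ := by field_simp
    rw [e]
    have h2 : C * ρ * φ / ρ₁ ≤ φN - φ := by
      rw [div_le_iff₀ hρ₁0]
      linarith
    linarith
  have hrung := noMarkedChunkAt_mono_phi hfrac (htr F ρ φ hρ hφ0 hR ρ₁ h3 h18) N y hy c hl hv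
  have hpay := hN ρ₁ hρe N y hy c hl hv hrung
  have hcap := hceil ρ₁ hρc N y hy c
  have hfill := cube_le_eight_mul_card_of_voidFree (by linarith) hv ⟨i, hin⟩
  have hBpos : (1 : ℝ) ≤ (B.card : ℝ) := by
    have : i ∈ B := Finset.mem_filter.mpr ⟨Finset.mem_univ _, hin⟩
    exact_mod_cast Finset.card_pos.mpr ⟨i, this⟩
  -- κ #B ≤ (κ/18) #B + (κ/18) ρ₁³ ≤ (κ/18)(1 + 8) #B = κ #B / 2
  have h1 : κ * (B.card : ℝ) ≤ κ / 18 * (B.card : ℝ) + κ / 18 * ρ₁ ^ 3 := hpay.trans hcap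
  have h2 : κ / 18 * ρ₁ ^ 3 ≤ κ / 18 * (8 * (B.card : ℝ)) := mul_le_mul_of_nonneg_left hfill (by positivity)
  have h4 : 0 < κ * (B.card : ℝ) := mul_pos hκ (by linarith)
  nlinarith

/-- **NEAR(φ_N) ∧ exclusion ⟹ NLC** (modulo CEIL). -/
theorem noLooseChunks_of_near_exclusion (hC : GSWindowCeiling) {F : SiteMarker} {φN : ℝ} (hφN : 0 < φN) (hN : MarkedNearGapAt F φN)
    (hX : MarkedChunkExclusion F) : NoLooseChunks := by
  obtain ⟨ρe, hρe⟩ := hX (φN / 2) (by positivity)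
  exact noLooseChunks_of_nearAt_rung hC hN (le_max_right ρe 1) (by positivity) (by linarith) (hρe _ (le_max_left _ _))

/-- **THE MERGER** (modulo CEIL): NLC ⟺ NEAR ∧ exclusion — for EVERY marker `F`. -/
theorem noLooseChunks_iff_near_exclusion (hC : GSWindowCeiling) (F : SiteMarker) :
    NoLooseChunks ↔ (∃ φ : ℝ, 0 < φ ∧ MarkedNearGapAt F φ) ∧ MarkedChunkExclusion F :=
  ⟨fun h => ⟨⟨1, one_pos, markedNearGapAt_of_noLooseChunks h F 1⟩, markedChunkExclusion_of_noLooseChunks h F⟩,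
    fun ⟨⟨_, hφ, hN⟩, hX⟩ => noLooseChunks_of_near_exclusion hC hφ hN hX⟩

/-- **THE MARKER IS IMMATERIAL** (modulo CEIL): the conjunction NEAR(F) ∧ exclusion(F) does not depend on the marker. -/
theorem near_exclusion_marker_immaterial (hC : GSWindowCeiling) (F G : SiteMarker) :
    ((∃ φ : ℝ, 0 < φ ∧ MarkedNearGapAt F φ) ∧ MarkedChunkExclusion F) ↔
      ((∃ φ : ℝ, 0 < φ ∧ MarkedNearGapAt G φ) ∧ MarkedChunkExclusion G) := by
  rw [← noLooseChunks_iff_near_exclusion hC F, ← noLooseChunks_iff_near_exclusion hC G]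

/-- **THE CUT IS EXACT AT EVERY FRACTION** (modulo CEIL): for every marker `F` and every `φ > 0`, NLC ⟺ NEAR(φ) ∧ «`Φ_∞(F) < φ`». -/
theorem noLooseChunks_iff_nearAt_dip (hC : GSWindowCeiling) {F : SiteMarker} {φ : ℝ} (hφ : 0 < φ) :
    NoLooseChunks ↔ MarkedNearGapAt F φ ∧ markedProfileInf F < φ := by
  constructor
  · intro h
    refine ⟨markedNearGapAt_of_noLooseChunks h F φ, ?_⟩
    rw [markedProfileInf_eq_zero_of_noLooseChunks h F]
    exact hφ
  · rintro ⟨hN, hD⟩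
    obtain ⟨ρ, hρ, hlt⟩ := markedProfileInf_lt_iff.mp hD
    exact noLooseChunks_of_nearAt_rung hC hN hρ (markedProfile_nonneg F ρ) hlt (noMarkedChunkAt_markedProfile F ρ)

/-- … at the level of ONE radius: NEAR(φ_N) and a profile value `Φ_F(ρ) < φ_N` at ANY single `ρ ≥ 1` give NLC. -/
theorem noLooseChunks_of_nearAt_profile (hC : GSWindowCeiling) {F : SiteMarker} {φN ρ : ℝ} (hN : MarkedNearGapAt F φN) (hρ : 1 ≤ ρ)
    (hΦ : markedProfile F ρ < φN) : NoLooseChunks :=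
  noLooseChunks_of_nearAt_rung hC hN hρ (markedProfile_nonneg F ρ) hΦ (noMarkedChunkAt_markedProfile F ρ)

/-- … or ONE open implant door `MarkedImplantDoor F ρ φ` at `ρ ≥ 1`, `0 ≤ φ < φ_N`. -/
theorem noLooseChunks_of_nearAt_door (hC : GSWindowCeiling) {F : SiteMarker} {φN ρ φ : ℝ} (hN : MarkedNearGapAt F φN) (hρ : 1 ≤ ρ)
    (hφ0 : 0 ≤ φ) (hφ : φ < φN) (hD : MarkedImplantDoor F ρ φ) : NoLooseChunks :=
  noLooseChunks_of_nearAt_rung hC hN hρ hφ0 hφ (noMarkedChunkAt_of_implantDoor hD)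

/-- **QUANTISATION OF THE NUMBER** (modulo CEIL): NEAR at fraction `φ_N` forces `Φ_∞(F) = 0 ∨ φ_N ≤ Φ_∞(F)` — the profile cannot converge to
a small positive number; ONE certified bound `Φ_∞ < φ_N` finishes it. -/
theorem markedProfileInf_dichotomy (hC : GSWindowCeiling) {F : SiteMarker} {φN : ℝ} (hN : MarkedNearGapAt F φN) :
    markedProfileInf F = 0 ∨ φN ≤ markedProfileInf F := by
  by_cases hlt : markedProfileInf F < φN
  · obtain ⟨ρ, hρ, hΦ⟩ := markedProfileInf_lt_iff.mp hlt
    exact Or.inl (markedProfileInf_eq_zero_of_noLooseChunks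
      (noLooseChunks_of_nearAt_rung hC hN hρ (markedProfile_nonneg F ρ) hΦ (noMarkedChunkAt_markedProfile F ρ)) F)
  · exact Or.inr (not_lt.mp hlt)

/-- Modulo NEAR(φ) (and CEIL): «`Φ_∞(F) < φ`» ⟺ exclusion ⟺ NLC. -/
theorem dip_iff_markedChunkExclusion (hC : GSWindowCeiling) {F : SiteMarker} {φ : ℝ} (hφ : 0 < φ) (hN : MarkedNearGapAt F φ) :
    markedProfileInf F < φ ↔ MarkedChunkExclusion F :=
  ⟨fun hD => markedChunkExclusion_of_noLooseChunks ((noLooseChunks_iff_nearAt_dip hC hφ).mpr ⟨hN, hD⟩) F,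
    dip_of_markedChunkExclusion hφ⟩

/-- **THE DOOR LADDER AT ONE RADIUS** (order, CEIL-free): at a radius `r ≥ 1` and a fraction `φ ≥ 0`,
`ChunkDoor r ⟹ MarkedImplantDoor F r 0 ⟹ MarkedImplantDoor F r φ`, finishing respectively NLC, exclusion (`Φ_∞(F) = 0`), `Φ_∞(F) ≤ φ`. -/
theorem door_ladder (F : SiteMarker) {r φ : ℝ} (hr : 1 ≤ r) (hφ : 0 ≤ φ) :
    (ChunkDoor r → MarkedImplantDoor F r 0) ∧ (MarkedImplantDoor F r 0 → MarkedImplantDoor F r φ) ∧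
      (ChunkDoor r → NoLooseChunks) ∧ (MarkedImplantDoor F r 0 → MarkedChunkExclusion F) ∧
        (MarkedImplantDoor F r φ → markedProfileInf F ≤ φ) :=
  ⟨markedImplantDoor_of_chunkDoor F le_rfl, markedImplantDoor_mono_phi hφ, noLooseChunks_of_chunkDoor (by linarith),
    fun h => markedChunkExclusion_of_rung_zero (by linarith) (noMarkedChunkAt_of_implantDoor h),
    fun h => markedProfileInf_le_of_implantDoor hr hφ h⟩


/-! ## §7 Pricing the cut (marker-generic): PAY(κ₀), SLACK(σ), the pointwise floor `SiteFloor d m`, the threshold-free cut -/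

/-- **PAY(κ₀) at one radius · `MarkedPayAt F ρ₁ κ₀`**: on every all-`(3/50)`-loose 2-void-free doubled ground-state window the UNMARKED particles
of the inner ball pay `κ₀` each above `e⋆`: `κ₀·#{i ∈ B(c,ρ₁) ∖ F} ≤ Σ_{i ∈ B(c,ρ₁) ∖ F} (𝓔ⁱ/2 − e⋆)`.  (Fraction-free; the lineage's NEAR′ core law.) -/
def MarkedPayAt (F : SiteMarker) (ρ₁ κ₀ : ℝ) : Prop :=
  ∀ (N : ℕ) (y : Fin N → EuclideanSpace ℝ (Fin 3)), IsGroundState lennardJones y →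
    ∀ c : EuclideanSpace ℝ (Fin 3),
      (∀ i : Fin N, dist (y i) c ≤ 2 * ρ₁ → i ∈ looseSet (3 / 50) y) →
        (∀ i : Fin N, dist (y i) c ≤ 2 * ρ₁ → i ∉ voidAdjSet 2 y) →
          κ₀ * ((Finset.univ.filter fun i : Fin N => dist (y i) c ≤ ρ₁ ∧ i ∉ F N y).card : ℝ)
            ≤ ∑ i ∈ Finset.univ.filter (fun i : Fin N => dist (y i) c ≤ ρ₁ ∧ i ∉ F N y), (siteEnergy lennardJones y i / 2 - eStar)

/-- **PAY(κ₀) · `MarkedPay F κ₀`** — eventually in the radius. -/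
def MarkedPay (F : SiteMarker) (κ₀ : ℝ) : Prop := ∃ ρe : ℝ, ∀ ρ₁ : ℝ, ρe ≤ ρ₁ → MarkedPayAt F ρ₁ κ₀

/-- **SLACK(σ) at one radius · `MarkedSlackAt F ρ₁ σ`**: on the same windows the MARKED particles of the inner ball are at most `σ` each below `e⋆`:
`−σ·#{i ∈ B(c,ρ₁) ∩ F} ≤ Σ_{i ∈ B(c,ρ₁) ∩ F} (𝓔ⁱ/2 − e⋆)`. -/
def MarkedSlackAt (F : SiteMarker) (ρ₁ σ : ℝ) : Prop :=
  ∀ (N : ℕ) (y : Fin N → EuclideanSpace ℝ (Fin 3)), IsGroundState lennardJones y →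
    ∀ c : EuclideanSpace ℝ (Fin 3),
      (∀ i : Fin N, dist (y i) c ≤ 2 * ρ₁ → i ∈ looseSet (3 / 50) y) →
        (∀ i : Fin N, dist (y i) c ≤ 2 * ρ₁ → i ∉ voidAdjSet 2 y) →
          -(σ * ((Finset.univ.filter fun i : Fin N => dist (y i) c ≤ ρ₁ ∧ i ∈ F N y).card : ℝ))
            ≤ ∑ i ∈ Finset.univ.filter (fun i : Fin N => dist (y i) c ≤ ρ₁ ∧ i ∈ F N y), (siteEnergy lennardJones y i / 2 - eStar)

/-- **SLACK(σ) · `MarkedSlack F σ`** — eventually in the radius. -/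
def MarkedSlack (F : SiteMarker) (σ : ℝ) : Prop := ∃ ρe : ℝ, ∀ ρ₁ : ℝ, ρe ≤ ρ₁ → MarkedSlackAt F ρ₁ σ

/-- **THE PRICING KERNEL at one radius**: PAY(κ₀) ∧ SLACK(σ) ⟹ windows of marked fraction `≤ φ` pay `κ₀ − φ·(κ₀+σ)` per particle. -/
theorem markedNearCertAt_of_pay_slack {F : SiteMarker} {ρ₁ κ₀ σ φ : ℝ} (hκ₀ : 0 ≤ κ₀) (hσ : 0 ≤ σ) (hP : MarkedPayAt F ρ₁ κ₀)
    (hS : MarkedSlackAt F ρ₁ σ) : MarkedNearCertAt F ρ₁ φ (κ₀ - φ * (κ₀ + σ)) := by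
  intro N y hy c hl hv hfrac
  set B := Finset.univ.filter (fun i : Fin N => dist (y i) c ≤ ρ₁) with hB
  set Fm := Finset.univ.filter (fun i : Fin N => dist (y i) c ≤ ρ₁ ∧ i ∈ F N y) with hF
  set G := Finset.univ.filter (fun i : Fin N => dist (y i) c ≤ ρ₁ ∧ i ∉ F N y) with hG
  have hFB : Fm = B.filter (fun i => i ∈ F N y) := by rw [hF, hB, Finset.filter_filter]
  have hGB : G = B.filter (fun i => ¬ i ∈ F N y) := by rw [hG, hB, Finset.filter_filter]
  have hsum : ∑ i ∈ B, (siteEnergy lennardJones y i / 2 - eStar)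
      = ∑ i ∈ Fm, (siteEnergy lennardJones y i / 2 - eStar) + ∑ i ∈ G, (siteEnergy lennardJones y i / 2 - eStar) := by
    rw [hFB, hGB, Finset.sum_filter_add_sum_filter_not]
  have hcard : (B.card : ℝ) = (Fm.card : ℝ) + (G.card : ℝ) := by
    rw [hFB, hGB]
    exact_mod_cast (Finset.card_filter_add_card_filter_not (fun i => i ∈ F N y)).symm
  have hPay := hP N y hy c hl hv
  have hSl := hS N y hy c hl hv
  rw [← hG] at hPay
  rw [← hF] at hSl
  have hFle : (Fm.card : ℝ) ≤ φ * (B.card : ℝ) := hfrac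
  have hF0 : (0 : ℝ) ≤ (Fm.card : ℝ) := Nat.cast_nonneg _
  rw [hsum]
  have h1 : (κ₀ + σ) * (Fm.card : ℝ) ≤ (κ₀ + σ) * (φ * (B.card : ℝ)) := mul_le_mul_of_nonneg_left hFle (by linarith)
  nlinarith

/-- **THE PRICING KERNEL**: PAY(κ₀) ∧ SLACK(σ) ∧ `φ·(κ₀+σ) < κ₀` ⟹ NEAR(φ). -/
theorem markedNearGapAt_of_pay_slack {F : SiteMarker} {κ₀ σ φ : ℝ} (hκ₀ : 0 ≤ κ₀) (hσ : 0 ≤ σ) (hφ : φ * (κ₀ + σ) < κ₀)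
    (hP : MarkedPay F κ₀) (hS : MarkedSlack F σ) : MarkedNearGapAt F φ := by
  obtain ⟨ρP, hP⟩ := hP
  obtain ⟨ρS, hS⟩ := hS
  exact ⟨κ₀ - φ * (κ₀ + σ), by linarith, max ρP ρS, fun ρ₁ hρ₁ =>
    markedNearCertAt_of_pay_slack hκ₀ hσ (hP ρ₁ (le_trans (le_max_left _ _) hρ₁)) (hS ρ₁ (le_trans (le_max_right _ _) hρ₁))⟩

/-- **THE THRESHOLD-FREE CUT** (modulo CEIL): NLC ⟸ PAY(κ₀) ∧ SLACK(σ) ∧ «`Φ_∞(F) < κ₀/(κ₀+σ)`» — the dip threshold is the RATIO of the near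
price to the near price plus the marked slack; no numeral is chosen by hand. -/
theorem noLooseChunks_of_pay_slack_dip (hC : GSWindowCeiling) {F : SiteMarker} {κ₀ σ : ℝ} (hκ₀ : 0 < κ₀) (hσ : 0 ≤ σ)
    (hP : MarkedPay F κ₀) (hS : MarkedSlack F σ) (hD : markedProfileInf F < κ₀ / (κ₀ + σ)) : NoLooseChunks := by
  have hpos : 0 < κ₀ + σ := by linarith
  obtain ⟨φ, hΦφ, hφt⟩ := exists_between hD
  have hφ : φ * (κ₀ + σ) < κ₀ := by rwa [lt_div_iff₀ hpos] at hφt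
  have hφ0 : 0 < φ := lt_of_le_of_lt (markedProfileInf_nonneg F) hΦφ
  exact (noLooseChunks_iff_nearAt_dip hC hφ0).mpr ⟨markedNearGapAt_of_pay_slack hκ₀.le hσ hφ hP hS, hΦφ⟩

/-- PAY(κ₀) is STRONGER than NEAR(0) (marker-free inner balls: every particle is unmarked). -/
theorem markedNearGapAt_zero_of_pay {F : SiteMarker} {κ₀ : ℝ} (hκ₀ : 0 < κ₀) (hP : MarkedPay F κ₀) : MarkedNearGapAt F 0 := by
  obtain ⟨ρe, hP⟩ := hP
  refine ⟨κ₀, hκ₀, ρe, fun ρ₁ hρ₁ N y hy c hl hv hfrac => ?_⟩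
  have hP1 := hP ρ₁ hρ₁ N y hy c hl hv
  have hF0 : (Finset.univ.filter fun i : Fin N => dist (y i) c ≤ ρ₁ ∧ i ∈ F N y) = ∅ := by
    rw [zero_mul] at hfrac
    have : (Finset.univ.filter fun i : Fin N => dist (y i) c ≤ ρ₁ ∧ i ∈ F N y).card = 0 := by
      exact_mod_cast le_antisymm hfrac (Nat.cast_nonneg _)
    exact Finset.card_eq_zero.mp this
  have hGB : (Finset.univ.filter fun i : Fin N => dist (y i) c ≤ ρ₁ ∧ i ∉ F N y)
      = Finset.univ.filter (fun i : Fin N => dist (y i) c ≤ ρ₁) := by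
    ext i
    simp only [Finset.mem_filter, Finset.mem_univ, true_and]
    refine ⟨fun h => h.1, fun hi => ⟨hi, fun hfar => ?_⟩⟩
    have : i ∈ (Finset.univ.filter fun i : Fin N => dist (y i) c ≤ ρ₁ ∧ i ∈ F N y) :=
      Finset.mem_filter.mpr ⟨Finset.mem_univ _, hi, hfar⟩
    rw [hF0] at this
    simp at this
  rw [hGB] at hP1
  exact hP1

/-- **`SiteFloor d m` — THE POINTWISE FLOOR AT SEPARATION `d`** [GS-free · `N`-free · `e⋆`-free · marker-free · one number]: in every injective
`d`-separated finite configuration of `ℝ³`, every particle has Lennard-Jones site energy `≥ m`.  The optimal `m(d)` is MINUS the «Lennard-Jones kissing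
energy at separation `d`»; a finite-range truncation plus `r⁻⁶` shell tails makes `SiteFloor d m` a CERTIFIED-COMPUTATION target (census instrument;
spec `SITEFLOOR-SPEC-g24.md` of cell `decomp-a2c`). -/
def SiteFloor (d m : ℝ) : Prop :=
  ∀ (N : ℕ) (y : Fin N → EuclideanSpace ℝ (Fin 3)), Function.Injective y →
    (∀ i j : Fin N, i ≠ j → d ≤ dist (y i) (y j)) → ∀ i : Fin N, m ≤ siteEnergy lennardJones y i

/-- A floor at a smaller separation is a floor at every larger one. -/
theorem siteFloor_anti {d d' m : ℝ} (hd : d ≤ d') (h : SiteFloor d m) : SiteFloor d' m :=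
  fun N y hy hsep i => h N y hy (fun i j hij => hd.trans (hsep i j hij)) i

/-- A floor may be lowered. -/
theorem siteFloor_mono_m {d m m' : ℝ} (hm : m' ≤ m) (h : SiteFloor d m) : SiteFloor d m' :=
  fun N y hy hsep i => hm.trans (h N y hy hsep i)

/-- **SLACK ⟸ the pointwise floor**: `SiteFloor d m` ∧ «every ground state is `d`-separated» ∧ `e⋆ ≤ m/2 + σ` ⟹ `MarkedSlackAt F ρ₁ σ` at EVERY radius
and for EVERY marker. -/
theorem markedSlackAt_of_siteFloor {d m σ : ℝ} (hF : SiteFloor d m)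
    (hGS : ∀ (N : ℕ) (y : Fin N → EuclideanSpace ℝ (Fin 3)), IsGroundState lennardJones y → ∀ i j : Fin N, i ≠ j → d ≤ dist (y i) (y j))
    (hσ : eStar ≤ m / 2 + σ) (F : SiteMarker) (ρ₁ : ℝ) : MarkedSlackAt F ρ₁ σ := by
  intro N y hy c _ _
  set Fm := Finset.univ.filter (fun i : Fin N => dist (y i) c ≤ ρ₁ ∧ i ∈ F N y) with hFdef
  have hpt : ∀ i ∈ Fm, -σ ≤ siteEnergy lennardJones y i / 2 - eStar := by
    intro i _
    have hm := hF N y hy.1 (hGS N y hy) i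
    linarith
  calc -(σ * (Fm.card : ℝ)) = ∑ _i ∈ Fm, (-σ) := by rw [Finset.sum_const, nsmul_eq_mul]; ring
    _ ≤ ∑ i ∈ Fm, (siteEnergy lennardJones y i / 2 - eStar) := Finset.sum_le_sum hpt

/-- `SiteFloor d m` at a proved ground-state separation `d` and `e⋆ ≤ m/2 + σ` give SLACK(σ) for every marker. -/
theorem markedSlack_of_siteFloor {d m σ : ℝ} (hF : SiteFloor d m)
    (hGS : ∀ (N : ℕ) (y : Fin N → EuclideanSpace ℝ (Fin 3)), IsGroundState lennardJones y → ∀ i j : Fin N, i ≠ j → d ≤ dist (y i) (y j))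
    (hσ : eStar ≤ m / 2 + σ) (F : SiteMarker) : MarkedSlack F σ :=
  ⟨0, fun ρ₁ _ => markedSlackAt_of_siteFloor hF hGS hσ F ρ₁⟩

/-- … at the separation constant `gsMinDist` (PART 1; its VALUE is the open «minimal distance» problem). -/
theorem markedSlack_of_siteFloor_gsMinDist {m σ : ℝ} (hF : SiteFloor gsMinDist m) (hσ : eStar ≤ m / 2 + σ) (F : SiteMarker) :
    MarkedSlack F σ :=
  markedSlack_of_siteFloor hF (fun _ _ hy _ _ hij => gsMinDist_le_dist hy hij) hσ F

/-- … at the TREE's proved separation `7/10` (`lennardJones_groundState_dist_ge_seven_tenths`). -/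
theorem markedSlack_of_siteFloor_seven_tenths {m σ : ℝ} (hF : SiteFloor (7 / 10) m) (hσ : eStar ≤ m / 2 + σ) (F : SiteMarker) :
    MarkedSlack F σ :=
  markedSlack_of_siteFloor_gsMinDist (siteFloor_anti seven_tenths_le_gsMinDist hF) hσ F

/-- **THE PRICED CUT FROM A CERTIFIED FLOOR** (modulo CEIL): PAY(κ₀), a floor `SiteFloor gsMinDist m`, `e⋆ ≤ m/2 + σ` and ONE profile bound
`Φ_∞(F) < κ₀/(κ₀+σ)` give NLC. -/
theorem noLooseChunks_of_pay_siteFloor_dip (hC : GSWindowCeiling) {F : SiteMarker} {κ₀ m σ : ℝ} (hκ₀ : 0 < κ₀) (hσ0 : 0 ≤ σ)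
    (hP : MarkedPay F κ₀) (hF : SiteFloor gsMinDist m) (hσ : eStar ≤ m / 2 + σ) (hD : markedProfileInf F < κ₀ / (κ₀ + σ)) :
    NoLooseChunks :=
  noLooseChunks_of_pay_slack_dip hC hκ₀ hσ0 hP (markedSlack_of_siteFloor_gsMinDist hF hσ F) hD

end Summit.AtomisticToContinuum.Crystallization.Theorems.ContactSaturationLadderChunkDoor

end
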